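import Mathlib
import Summits.ValiantsHypothesis.ValiantsHypothesis.Theorems.LacunarySymmetroidMatrixDescartesCensusPivotTwoDescartes
import Summits.ValiantsHypothesis.ValiantsHypothesis.Theorems.LacunarySymmetroidMatrixDescartesWLawTwoSignBudgets
import Summits.ValiantsHypothesis.ValiantsHypothesis.Theorems.KPlusLogSqLawWeakLiftingTowerGraftTowerTwoSidedWitness
import Summits.ValiantsHypothesis.ValiantsHypothesis.Theorems.KPlusLogSqLawWeakLiftingTowerGraftTowerTwoSidedWitnessEight

/-!
# Tower graft line — the `m = 2` TOWER ROW IS DESCARTES-EXACT: `Z₊ ≤ 2K` for the two-sided `2 × 2` word with `K` PSD letters,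
# `= 6` at four letters (`T₂₄`) and `= 8` at five (`T₅₈`)

Crux `stmt-ValiantsHypothesis-19561` (`Theses.KPlusLogSqLaw.WeakLifting`), line (B) `Cruxes/WeakLifting/Lines/tower_graft.lean`
(restricted sub-case `TowerWeakLifting`).  The cell's two-sided tower column at `m = 2` has the KERNEL lower bounds `Z₊ ≥ 6 = 3m`
(`T₂₄`, four letters, p675647) and `Z₊ ≥ 8 = 4m` (`T₅₈`, five letters, p678743); the matching ceilings were LOCATED only (the cell's DP
`descartes_cap`: `2(b+1)` for the `(1,b)` word).  This file types the ceiling, for every number of letters, by ASSEMBLING TREE TOOLS: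
the census pivot column's coefficient calculus for `2 × 2` pivot words (`Pivot.TwoDescartes`: negative coefficients of
`det(X^e J + ∑ X^{dₖ} Pₖ)` sit only at `2e` and `e + dₖ` — `coeff_det`, `agg_eq_zero`, `coeff_det_nonneg_of_not_mem`; generic bound
`Z₊ ≤ 2K + 2`, conjb-1) and the W-law toolkit's CLUSTERED SIGN BUDGET (`WLawTwoChambers.signVariations_pair_budget`, mdr-p1: two members
`u < v` of the negative set with only zero coefficients strictly between them save `2`).  ON A TOWER the two lowest possibly-negative
exponents `u = e + d₀` (`d₀` the top letter below the pivot) and `v = 2e` ARE such a pair: every other pair-sum of exponents is `< u`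
(two letters below the pivot) or `> v` (a letter above the pivot, which on a 2-tower exceeds `2e`).  Hence

* `TowerRowTwoCap.card_posRoots_le_two_mul` — for `P k ⪰ 0` (`k < K`), `J` ARBITRARY, some letter below the pivot (`d k₀ < e`, `k₀` a top
  one among those) and every letter not below the pivot beyond `2e`: `Z₊ ≤ 2K` (vs. the support-free `2K + 2`);
* law-shaped cells: `towerTwoSidedLaw_two_three_mul` (`K = 3` PSD letters, `(1,2)` configuration, 2-tower: `≤ 3·2`) and
  `towerTwoSidedLaw_two_five_letters` (`K = 4`: `≤ 8`);
* EXACTNESS: `card_posRoots_T₂₄_eq_six`, `card_posRoots_T₅₈_eq_eight` — the witnesses of p675647 / p678743 are extremal for their words,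
  so the instrument's column reads `2, =6, 10, ≥ 12` with the `m = 2` cell closed in the kernel (and the five-letter `m = 2` cell `= 8`).

Def-free.  HONEST FRAMING: an upper bound in ONE row (`m = 2`) of the instrument's table, assembled from landed census tools; it proves
nothing about `WeakLifting`, Conjecture B / `KPlusLogSqLaw`, the registered stubs S4/S4b/S4d/S4f/S5/S5ᴸ, `MatrixDescartes` (18050) or
`VP ≠ VNP`.  Seat: prover val-sym-lift-p3 g19, `--supports stmt-ValiantsHypothesis-19561`.

[folklore] Descartes' rule of signs with clustered negative coefficients (tree files `…CensusPivotTwoDescartes`, `…WLawTwoSignBudgets`).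
-/

-- `Summit.ValiantsHypothesis.ValiantsHypothesis.…` repeats a component by the D-0017 layout
-- (single-conjunct summit), which the `dupNamespace` linter flags; the name is mandated.
set_option linter.dupNamespace false

namespace Summit.ValiantsHypothesis.ValiantsHypothesis.Theorems.KPlusLogSqLaw.TowerGraft

open Finset Polynomial Matrix
open scoped BigOperators Polynomial
open Summit.ValiantsHypothesis.ValiantsHypothesis.Theorems.LacunarySymmetroidMatrixDescartes.Pivot.TwoDescartes
  (letter expo agg pencil_eq_sum coeff_det agg_eq_zero coeff_det_nonneg_of_not_mem)
open Summit.ValiantsHypothesis.ValiantsHypothesis.Theorems.LacunarySymmetroidMatrixDescartes.WLawTwoChambers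
  (signVariations_pair_budget card_posRoots_le_signVariations)

namespace TowerRowTwoCap

variable {K : ℕ}

/-- On a tower, no coefficient of `det` lies strictly between `e + d k₀` (`d k₀` the top exponent below the pivot) and `2e`:
every pair-sum of letter exponents is `≤ e + d k₀` or `≥ 2e`. [folklore] -/
theorem coeff_det_eq_zero_gap (e : ℕ) (d : Fin K → ℕ) (J : Matrix (Fin 2) (Fin 2) ℝ) (P : Fin K → Matrix (Fin 2) (Fin 2) ℝ)
    (k₀ : Fin K) (htop : ∀ k, d k < e → d k ≤ d k₀) (hup : ∀ k, e ≤ d k → 2 * e < d k)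
    (m : ℕ) (hum : e + d k₀ < m) (hmv : m < 2 * e) :
    (Matrix.det (∑ l, ((X : ℝ[X]) ^ expo e d l) • (letter J P l).map Polynomial.C)).coeff m = 0 := by
  rw [coeff_det]
  refine Finset.sum_eq_zero fun x hx => ?_
  obtain ⟨a, b⟩ := x
  replace hx : a + b = m := by simpa using hx
  -- exponent of a letter: `e` or some `d k`; classify
  have hrange : ∀ l : Option (Fin K), expo e d l = e ∨ (expo e d l < e ∧ expo e d l ≤ d k₀) ∨ 2 * e < expo e d l := by
    intro l
    rcases l with _ | k
    · exact Or.inl rfl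
    · simp only [expo]
      rcases lt_or_ge (d k) e with h | h
      · exact Or.inr (Or.inl ⟨h, htop k h⟩)
      · exact Or.inr (Or.inr (hup k h))
  by_cases ha : ∃ l, expo e d l = a
  · by_cases hb : ∃ l, expo e d l = b
    · exfalso
      obtain ⟨l, hl⟩ := ha
      obtain ⟨l', hl'⟩ := hb
      have h1 := hrange l
      have h2 := hrange l'
      rw [hl] at h1
      rw [hl'] at h2
      omega
    · push Not at hb
      rw [agg_eq_zero e d J P b hb]
      simp
  · push Not at ha
    rw [agg_eq_zero e d J P a ha]
    simp

/-- **TOWER ROW AT `m = 2`: `Z₊ ≤ 2K`.**  For the `2 × 2` word `X^e • J + ∑_{k<K} X^{d k} • P k` with `P k ⪰ 0`, `J` arbitrary, some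
letter below the pivot (`d k₀ < e`, `k₀` a top one among those below) and every letter not below the pivot beyond `2e` (automatic on a
2-tower), `det` has at most `2K` distinct positive roots (support-free bound: `2K + 2`, `Pivot.TwoDescartes.pivotTwo_posRoots_le`).
[folklore] -/
theorem card_posRoots_le_two_mul (e : ℕ) (d : Fin K → ℕ) (J : Matrix (Fin 2) (Fin 2) ℝ) (P : Fin K → Matrix (Fin 2) (Fin 2) ℝ)
    (hP : ∀ k, (P k).PosSemidef) (k₀ : Fin K) (hk₀ : d k₀ < e) (htop : ∀ k, d k < e → d k ≤ d k₀)
    (hup : ∀ k, e ≤ d k → 2 * e < d k) :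
    ((Matrix.det (((X : ℝ[X]) ^ e) • J.map Polynomial.C
        + ∑ k, ((X : ℝ[X]) ^ d k) • (P k).map Polynomial.C)).roots.toFinset.filter (fun t => 0 < t)).card ≤ 2 * K := by
  classical
  rw [pencil_eq_sum]
  set Q : ℝ[X] := Matrix.det (∑ l, ((X : ℝ[X]) ^ expo e d l) • (letter J P l).map Polynomial.C) with hQ
  let T : Finset ℕ := Finset.univ.image (fun l : Option (Fin K) => e + expo e d l)
  have hT : T.card ≤ K + 1 := by
    refine le_trans Finset.card_image_le ?_
    simp [Fintype.card_option]
  have hneg : ∀ n, Q.coeff n < 0 → n ∈ T := by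
    intro n hn
    by_contra hnot
    have hn' : ∀ l, e + expo e d l ≠ n := by
      intro l hl
      exact hnot (Finset.mem_image.mpr ⟨l, Finset.mem_univ _, hl⟩)
    exact absurd hn (not_lt.mpr (coeff_det_nonneg_of_not_mem e d J P hP n hn'))
  have hu : e + d k₀ ∈ T := Finset.mem_image.mpr ⟨some k₀, Finset.mem_univ _, rfl⟩
  have hv : 2 * e ∈ T := Finset.mem_image.mpr ⟨none, Finset.mem_univ _, by simp [expo]; ring⟩
  have hgap : ∀ m, e + d k₀ < m → m < 2 * e → Q.coeff m = 0 := fun m h1 h2 =>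
    coeff_det_eq_zero_gap e d J P k₀ htop hup m h1 h2
  have hbudget := signVariations_pair_budget Q T hneg (e + d k₀) (2 * e) (by omega) hu hv hgap
  have hroots := card_posRoots_le_signVariations Q
  have : (if Q.leadingCoeff < 0 then 1 else 0) ≥ 0 := Nat.zero_le _
  omega

end TowerRowTwoCap

open TowerRowTwoCap

/-- **TOWER ROW AT `m = 2` IS EXACT AT FOUR LETTERS (kernel): the two-sided `2 × 2` word on a 2-tower has `Z₊ ≤ 6 = 3m`**, for every
(even non-symmetric) pivot `J` and PSD letters in the `(1,2)` configuration `d₀ < e < d₁, d₂`; `T₂₄` (p675647) attains `6`.  The shape is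
that of `not_towerTwoSidedLaw_two` with `2·2` replaced by `3·2` (and only the tower clause `e < d k → 2e < d k` used). -/
theorem towerTwoSidedLaw_two_three_mul : ∀ (e : ℕ) (d : Fin 3 → ℕ) (J : Matrix (Fin 2) (Fin 2) ℝ)
    (P : Fin 3 → Matrix (Fin 2) (Fin 2) ℝ), (∀ k, (P k).PosSemidef) → d 0 < e → e < d 1 → e < d 2 →
    (∀ k, e < d k → 2 * e < d k) →
    ((Matrix.det (((Polynomial.X : Polynomial ℝ) ^ e) • J.map Polynomial.C
        + ∑ k, ((Polynomial.X : Polynomial ℝ) ^ d k) • (P k).map Polynomial.C)).roots.toFinset.filter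
          (fun t => 0 < t)).card ≤ 3 * 2 := by
  intro e d J P hP h0 h1 h2 htower
  have htop : ∀ k : Fin 3, d k < e → d k ≤ d 0 := by
    intro k hk
    fin_cases k
    · exact le_rfl
    · exact absurd hk (by simp; omega)
    · exact absurd hk (by simp; omega)
  have hup : ∀ k : Fin 3, e ≤ d k → 2 * e < d k := by
    intro k hk
    fin_cases k
    · exact absurd hk (by simp; omega)
    · exact htower 1 h1
    · exact htower 2 h2
  have h := card_posRoots_le_two_mul e d J P hP 0 h0 htop hup
  omega

/-- Five letters (`(1,3)` configuration on a 2-tower): `Z₊ ≤ 8 = 4m`; `T₅₈` (p678743) attains it. -/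
theorem towerTwoSidedLaw_two_five_letters : ∀ (e : ℕ) (d : Fin 4 → ℕ) (J : Matrix (Fin 2) (Fin 2) ℝ)
    (P : Fin 4 → Matrix (Fin 2) (Fin 2) ℝ), (∀ k, (P k).PosSemidef) → d 0 < e → e < d 1 → e < d 2 → e < d 3 →
    (∀ k, e < d k → 2 * e < d k) →
    ((Matrix.det (((Polynomial.X : Polynomial ℝ) ^ e) • J.map Polynomial.C
        + ∑ k, ((Polynomial.X : Polynomial ℝ) ^ d k) • (P k).map Polynomial.C)).roots.toFinset.filter
          (fun t => 0 < t)).card ≤ 8 := by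
  intro e d J P hP h0 h1 h2 h3 htower
  have htop : ∀ k : Fin 4, d k < e → d k ≤ d 0 := by
    intro k hk
    fin_cases k
    · exact le_rfl
    · exact absurd hk (by simp; omega)
    · exact absurd hk (by simp; omega)
    · exact absurd hk (by simp; omega)
  have hup : ∀ k : Fin 4, e ≤ d k → 2 * e < d k := by
    intro k hk
    fin_cases k
    · exact absurd hk (by simp; omega)
    · exact htower 1 h1
    · exact htower 2 h2
    · exact htower 3 h3
  have h := card_posRoots_le_two_mul e d J P hP 0 h0 htop hup
  omega

open TowerTwoSidedWitness in
/-- **EXACT CELL `(m, letters) = (2, 4)` ON TOWERS: `Z₊(T₂₄) = 6`** — the witness of p675647 is extremal for its word. -/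
theorem card_posRoots_T₂₄_eq_six : (T₂₄.det.roots.toFinset.filter (fun t => 0 < t)).card = 6 := by
  refine le_antisymm ?_ six_le_card_posRoots_T₂₄
  unfold T₂₄
  have h := towerTwoSidedLaw_two_three_mul e₂₄ d₂₄ J₂₄ P₂₄ P₂₄_posSemidef (by simp [d₂₄, e₂₄]) (by simp [d₂₄, e₂₄])
    (by simp [d₂₄, e₂₄]) tower₂₄.2.1
  omega

open TowerTwoSidedWitnessEight in
/-- **EXACT CELL `(m, letters) = (2, 5)` ON TOWERS: `Z₊(T₅₈) = 8`** — the witness of p678743 is extremal for its word. -/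
theorem card_posRoots_T₅₈_eq_eight : (T₅₈.det.roots.toFinset.filter (fun t => 0 < t)).card = 8 := by
  refine le_antisymm ?_ le_card_posRoots_T₅₈
  unfold T₅₈
  exact towerTwoSidedLaw_two_five_letters e₅₈ d₅₈ J₅₈ P₅₈ P₅₈_posSemidef (by simp [d₅₈, e₅₈]) (by simp [d₅₈, e₅₈])
    (by simp [d₅₈, e₅₈]) (by simp [d₅₈, e₅₈]) tower₅₈.2.1

end Summit.ValiantsHypothesis.ValiantsHypothesis.Theorems.KPlusLogSqLaw.TowerGraft
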